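import Mathlib
import Summits.ValiantsHypothesis.ValiantsHypothesis.Theorems.AlgebraicKWGamesOneAlternationLowerBoundCount

/-!
# Rank of algebraic-independence matroids under algebra endomorphisms

Support lemmas for item `stmt-ValiantsHypothesis-10299` (`…Theses.AlgebraicKWGames.BoundedAlternationLowerBound`).
For the matroid `Mat n` of `ℂ`-algebraically independent subsets of `ℂ[x, y]`
(`AlgebraicIndependent.matroid`, see `…OneAlternationLowerBoundCount`) and a `ℂ`-algebra endomorphism
`φ` of `ℂ[x, y]`:

* `indep_of_injOn_image`: independence pulls back along `φ`;
* `eRk_image_le`: `rk (φ '' W) ≤ rk W`;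
* `eRk_image_lt`: the inequality is strict as soon as `φ` kills a nonzero element of the subalgebra
  generated by the finite set `W` (pull back a basis, then `φ` is injective on the polynomial ring it
  generates and hence — by the lowest-coefficient argument `aeval_ne_zero_of_killed` — on everything
  algebraic over it).

These are the engine of the lexicographic rank potential of the bounded-alternation adversary.
Honest framing: bookkeeping for a toy-model lower bound; nothing here bears on VP versus VNP.
-/

open MvPolynomial

-- the summit and the problem share the name `ValiantsHypothesis` (D-0017 single-conjunct layout)
set_option linter.dupNamespace false

namespace Summit.ValiantsHypothesis.ValiantsHypothesis.Theorems.AlgebraicKWGames.OneAlt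

open scoped Classical

noncomputable section

variable {n : ℕ} (φ : R n →ₐ[ℂ] R n)

/-- A family injective onto an independent set is algebraically independent after `φ`, hence before. -/
theorem indep_of_injOn_image {I : Set (R n)} (hinj : Set.InjOn φ I) (hI : (Mat n).Indep (φ '' I)) :
    (Mat n).Indep I := by
  rw [AlgebraicIndependent.matroid_indep_iff] at hI ⊢
  let g : I → φ '' I := fun x => ⟨φ x, Set.mem_image_of_mem _ x.2⟩
  have hg : Function.Injective g := by
    intro a b hab
    apply Subtype.ext
    exact hinj a.2 b.2 (by simpa [g] using congrArg Subtype.val hab)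
  have h : AlgebraicIndependent ℂ (φ ∘ fun x : I => (x : R n)) := hI.comp g hg
  exact h.of_comp φ

/-- The family `φ ∘ (↑) : I → ℂ[x,y]` is algebraically independent when `φ` maps `I` injectively onto an
independent set. -/
theorem algebraicIndependent_comp_of_injOn {I : Set (R n)} (hinj : Set.InjOn φ I)
    (hI : (Mat n).Indep (φ '' I)) : AlgebraicIndependent ℂ (fun x : I => φ x) := by
  rw [AlgebraicIndependent.matroid_indep_iff] at hI
  let g : I → φ '' I := fun x => ⟨φ x, Set.mem_image_of_mem _ x.2⟩
  have hg : Function.Injective g := by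
    intro a b hab
    apply Subtype.ext
    exact hinj a.2 b.2 (by simpa [g] using congrArg Subtype.val hab)
  exact hI.comp g hg

/-- **Rank does not increase under `φ`.** -/
theorem eRk_image_le (W : Set (R n)) : (Mat n).eRk (φ '' W) ≤ (Mat n).eRk W := by
  obtain ⟨J, hJ⟩ := (Mat n).exists_isBasis (φ '' W) (by simp)
  obtain ⟨I, hIW, hbij⟩ := Set.exists_subset_bijOn (W ∩ φ ⁻¹' J) φ
  have hJeq : φ '' (W ∩ φ ⁻¹' J) = J := by
    ext q
    constructor
    · rintro ⟨w, ⟨-, hw⟩, rfl⟩; exact hw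
    · intro hq
      obtain ⟨w, hw, rfl⟩ := hJ.subset hq
      exact ⟨w, ⟨hw, hq⟩, rfl⟩
  rw [hJeq] at hbij
  have hIind : (Mat n).Indep I := indep_of_injOn_image φ hbij.injOn (hbij.image_eq.symm ▸ hJ.indep)
  calc (Mat n).eRk (φ '' W) = J.encard := hJ.encard_eq_eRk.symm
    _ = I.encard := by rw [← hbij.image_eq, hbij.injOn.encard_image]
    _ ≤ (Mat n).eRk W := hIind.encard_le_eRk_of_subset (hIW.trans Set.inter_subset_left)

/-- `φ` is injective on the polynomial subalgebra generated by a set it maps injectively onto an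
independent set. -/
theorem eq_zero_of_mem_adjoin_of_map_eq_zero {I : Set (R n)} (hinj : Set.InjOn φ I)
    (hI : (Mat n).Indep (φ '' I)) {a : R n} (ha : a ∈ Algebra.adjoin ℂ I) (h0 : φ a = 0) : a = 0 := by
  have hind := algebraicIndependent_comp_of_injOn φ hinj hI
  have ha' : a ∈ (aeval (R := ℂ) (fun x : I => (x : R n))).range := by
    rwa [← Algebra.adjoin_range_eq_range_aeval, Subtype.range_coe]
  obtain ⟨r, rfl⟩ := (AlgHom.mem_range _).mp ha'
  have h1 : φ (aeval (R := ℂ) (fun x : I => (x : R n)) r) = aeval (R := ℂ) (fun x : I => φ x) r := by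
    rw [← AlgHom.comp_apply, comp_aeval]
  rw [h1] at h0
  have hr : r = 0 := hind (by rw [h0, map_zero])
  rw [hr, map_zero]

/-- The lowest-coefficient argument: if `φ` is injective on `A` and `d ≠ 0` is killed by `φ`, then no
nonzero polynomial over `A` vanishes at `d`. -/
theorem aeval_ne_zero_of_killed (A : Subalgebra ℂ (R n)) (hA : ∀ a ∈ A, φ a = 0 → a = 0) {d : R n}
    (hd : d ≠ 0) (hφd : φ d = 0) : ∀ p : Polynomial A, p ≠ 0 → Polynomial.aeval d p ≠ 0 := by
  intro p
  induction h : p.natDegree using Nat.strong_induction_on generalizing p with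
  | _ N ih =>
    intro hp hzero
    by_cases hc : p.coeff 0 = 0
    · -- `p = divX p * X`
      have hdiv : Polynomial.divX p ≠ 0 := by
        intro hd0
        rw [Polynomial.divX_eq_zero_iff, hc, map_zero] at hd0
        exact hp hd0
      have hdeg : (Polynomial.divX p).natDegree < N := by
        rw [Polynomial.natDegree_divX_eq_natDegree_tsub_one, ← h]
        have : p.natDegree ≠ 0 := by
          intro h0
          apply hp
          rw [Polynomial.eq_C_of_natDegree_eq_zero h0, hc, map_zero]
        omega
      have hp' : p = Polynomial.divX p * Polynomial.X := by
        conv_lhs => rw [← Polynomial.divX_mul_X_add p]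
        rw [hc, map_zero, add_zero]
      have hz : Polynomial.aeval d (Polynomial.divX p) = 0 := by
        rw [hp', map_mul, Polynomial.aeval_X] at hzero
        rcases mul_eq_zero.mp hzero with h1 | h1
        · exact h1
        · exact (hd h1).elim
      exact ih _ hdeg _ rfl hdiv hz
    · -- the constant coefficient is killed by `φ`
      have hsplit : Polynomial.aeval d (Polynomial.divX p) * d + algebraMap A (R n) (p.coeff 0) =
          Polynomial.aeval d p := by
        conv_rhs => rw [← Polynomial.divX_mul_X_add p]
        rw [map_add, map_mul, Polynomial.aeval_X, Polynomial.aeval_C]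
      have hφc : φ (algebraMap A (R n) (p.coeff 0)) = 0 := by
        have := congrArg φ hsplit
        rw [hzero, map_zero, map_add, map_mul, hφd, mul_zero, zero_add] at this
        exact this
      have hcoe : algebraMap A (R n) (p.coeff 0) = 0 := hA _ (p.coeff 0).2 hφc
      apply hc
      exact Subtype.ext (by simpa using hcoe)

/-- **Strict rank drop.**  If `φ` kills a nonzero element of the subalgebra generated by the finite set
`W`, then `rk (φ '' W) < rk W`. -/
theorem eRk_image_lt {W : Set (R n)} (hW : W.Finite) {Q : R n} (hQ : Q ∈ Algebra.adjoin ℂ W)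
    (hQ0 : Q ≠ 0) (hφQ : φ Q = 0) : (Mat n).eRk (φ '' W) < (Mat n).eRk W := by
  refine lt_of_le_of_ne (eRk_image_le φ W) ?_
  intro heq
  -- pull back a basis of `φ '' W`
  obtain ⟨J, hJ⟩ := (Mat n).exists_isBasis (φ '' W) (by simp)
  obtain ⟨I, hIW, hbij⟩ := Set.exists_subset_bijOn (W ∩ φ ⁻¹' J) φ
  have hJeq : φ '' (W ∩ φ ⁻¹' J) = J := by
    ext q
    constructor
    · rintro ⟨w, ⟨-, hw⟩, rfl⟩; exact hw
    · intro hq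
      obtain ⟨w, hw, rfl⟩ := hJ.subset hq
      exact ⟨w, ⟨hw, hq⟩, rfl⟩
  rw [hJeq] at hbij
  have hIW' : I ⊆ W := hIW.trans Set.inter_subset_left
  have hIJ : (Mat n).Indep (φ '' I) := hbij.image_eq.symm ▸ hJ.indep
  have hIind : (Mat n).Indep I := indep_of_injOn_image φ hbij.injOn hIJ
  have hIcard : I.encard = (Mat n).eRk W := by
    rw [← hbij.injOn.encard_image, hbij.image_eq, hJ.encard_eq_eRk, heq]
  -- so `I` is a basis of `W`, and `W` is algebraic over `A = ℂ[I]`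
  have hIbasis : (Mat n).IsBasis I W :=
    hIind.isBasis_of_eRk_ge (hW.subset hIW') hIW' (by rw [hIind.eRk_eq_encard, hIcard])
  set A : Subalgebra ℂ (R n) := Algebra.adjoin ℂ I with hA
  have hWalg : W ⊆ ((Subalgebra.algebraicClosure A (R n)).restrictScalars ℂ : Subalgebra ℂ (R n)) := by
    intro w hw
    have := hIbasis.subset_closure hw
    rw [mem_closure_iff_isAlgebraic] at this
    exact this
  have hQalg : IsAlgebraic A Q := (Algebra.adjoin_le hWalg) hQ
  obtain ⟨p, hp0, hp⟩ := hQalg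
  have hAinj : ∀ a ∈ A, φ a = 0 → a = 0 := fun a ha h0 =>
    eq_zero_of_mem_adjoin_of_map_eq_zero φ hbij.injOn hIJ ha h0
  exact aeval_ne_zero_of_killed φ A hAinj hQ0 hφQ p hp0 hp

end

end Summit.ValiantsHypothesis.ValiantsHypothesis.Theorems.AlgebraicKWGames.OneAlt
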